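import Mathlib
import HarnessLib
import Summits.ResolutionOfSingularities.ResolutionOfSingularities.Theorems.WildQuotientsWildQuotientResolutionS1aValuativeAffine
import Summits.ResolutionOfSingularities.ResolutionOfSingularities.Theorems.WildQuotientsWildQuotientResolutionS1aValuativeAdmissible

/-!
# S1a — CRITERIA FOR σ-ADMISSIBILITY: the twisted Leibniz rule, and the monomial valuation on `k[x_σ]` (it suffices to check the coordinates)

[OURS · L1 W4.5c · lead-1 g9, TWISTED-INVARIANT-DESIGN v1 §2 made a lemma schema] — NOT statements of the manuscript; counted 0; AI-level work, weaker than
expert review. Crux stmt-ResolutionOfSingularities-17941 (`WildQuotients.CyclicQuotientFourfolds`), line `s1a-logminvertex` v10; serves the research defs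
`KillAdmValReach` / `AuxAdmValAt` (`…S1aValuativeAdmissible`, `CentredVal.IsSigmaAdmissible c σ δ :≡ ∀ y, v y + δ ≤ v (σ y − y)`). Route-independent; pure algebra.

* `Valuative.AdmAt v τ δ a :≡ v a + δ ≤ v (τ a − a)` for ANY `ℕ∞`-valued additive valuation `v` on a commutative ring and ANY ring endomorphism `τ`;
  ★ `admAt_mul` — the TWISTED LEIBNIZ RULE `τ(ab) − ab = (τa − a)·τb + a·(τb − b)` makes the admissible elements a multiplicative set (`admAt_of_map_eq`,
  `admAt_prod`, `admAt_pow`); sums are NOT automatic (cancellation).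
* `Valuative.polyVal w : AddValuation (MvPolynomial σ k) ℕ∞` — the weighted order of a polynomial (`weightedOrderVal` pulled back along `k[x] ↪ k⟦x⟧`);
  `polyVal_monomial`; ★★ `polyVal_admissible`: for a `k`-algebra endomorphism `τ` of `k[x_σ]`, admissibility ON THE COORDINATES
  (`w i + δ ≤ polyVal w (τ (X i) − X i)` for all `i`) implies admissibility on EVERY polynomial (monomials by the twisted Leibniz rule; sums because the
  monomial valuation of a polynomial is the minimum over its support, `AddValuation.map_le_sum`). This is the formal form of plan-1's hand arithmetic
  (TWISTED §2: "from σx₂ − x₂ = x₁: w₁ ≥ w₂ + δ; …"): the census frame's weight inequalities ARE σ-admissibility of the monomial valuation on the chart ring.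
* ★★ `CentredVal.isSigmaAdmissible_ofSections` — TRANSFER TO THE STALK: for `c = CentredVal.ofSections hU x ψ hψ v hv` and a stalk endomorphism `σ'`
  compatible on germs with a ring endomorphism `τ` of `Γ(X, U)` preserving non-vanishing at `x`, admissibility of `v ∘ ψ` w.r.t. `τ` on SECTIONS implies
  `c.IsSigmaAdmissible σ' δ` on the whole stalk (fractions `a/s`: `(σ'y − y)·τ(s)·s = ((τa − a)s − a(τs − s))` at the germ level, units have value `0`).
-/

set_option linter.dupNamespace false

noncomputable section

universe u

open MvPolynomial

namespace Summit.ResolutionOfSingularities.ResolutionOfSingularities.Theorems.WildQuotientResolution.S1.Valuative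

/-! ## 1. Admissible elements for a valuation and a ring endomorphism: the twisted Leibniz rule -/

section Generic

variable {B : Type*} [CommRing B] (v : AddValuation B ℕ∞) (τ : B →+* B) (δ : ℕ)

/-- `a` is **admissible** for `(v, τ, δ)`: `v(τ a − a) ≥ v(a) + δ`. [OURS · L1 W4.5c] -/
def AdmAt (a : B) : Prop := v a + δ ≤ v (τ a - a)

/-- `τ`-fixed elements are admissible (`v 0 = ⊤`). -/
theorem admAt_of_map_eq {a : B} (h : τ a = a) : AdmAt v τ δ a := by
  simp [AdmAt, h]

/-- An admissible element does not lose value under `τ`: `v a ≤ v (τ a)`. -/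
theorem le_map_of_admAt {a : B} (h : AdmAt v τ δ a) : v a ≤ v (τ a) := by
  have h1 : min (v (τ a - a)) (v a) ≤ v (τ a - a + a) := v.map_add _ _
  rw [sub_add_cancel] at h1
  exact le_trans (le_min (le_self_add.trans h) le_rfl) h1

/-- ★ **Twisted Leibniz**: admissible elements are closed under multiplication (`τ(ab) − ab = (τa − a)·τb + a·(τb − b)`). [OURS · L1 W4.5c] -/
theorem admAt_mul {a b : B} (ha : AdmAt v τ δ a) (hb : AdmAt v τ δ b) : AdmAt v τ δ (a * b) := by
  have hb' := le_map_of_admAt v τ δ hb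
  unfold AdmAt at *
  have e : τ (a * b) - a * b = (τ a - a) * τ b + a * (τ b - b) := by rw [map_mul]; ring
  rw [e, AddValuation.map_mul]
  refine le_trans (le_min ?_ ?_) (v.map_add _ _)
  · rw [AddValuation.map_mul]
    calc v a + v b + (δ : ℕ∞) = (v a + δ) + v b := add_right_comm _ _ _
      _ ≤ v (τ a - a) + v (τ b) := add_le_add ha hb'
  · rw [AddValuation.map_mul, add_assoc]
    exact add_le_add le_rfl hb

/-- Finite products of admissible elements are admissible. -/
theorem admAt_prod {ι : Type*} (s : Finset ι) (f : ι → B) (h : ∀ i ∈ s, AdmAt v τ δ (f i)) : AdmAt v τ δ (∏ i ∈ s, f i) :=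
  Finset.prod_induction f (AdmAt v τ δ) (fun _ _ ha hb => admAt_mul v τ δ ha hb) (admAt_of_map_eq v τ δ (map_one τ)) h

/-- Powers of an admissible element are admissible. -/
theorem admAt_pow {a : B} (h : AdmAt v τ δ a) (n : ℕ) : AdmAt v τ δ (a ^ n) := by
  induction n with
  | zero => rw [pow_zero]; exact admAt_of_map_eq v τ δ (map_one τ)
  | succ n ih => rw [pow_succ]; exact admAt_mul v τ δ ih h

end Generic

/-! ## 2. The weighted order of polynomials as a valuation, and admissibility from the coordinates -/

section Poly

variable {σ k : Type*} [Field k] (w : σ → ℕ)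

/-- **The weighted order of polynomials** `k[x_σ] ↪ k⟦x_σ⟧ → ℕ∞` as an additive valuation. [OURS packaging · L1 W4.5c] -/
def polyVal : AddValuation (MvPolynomial σ k) ℕ∞ :=
  (weightedOrderVal w).comap (MvPolynomial.coeToMvPowerSeries.ringHom (σ := σ) (R := k))

/-- Unfolding. -/
@[simp] theorem polyVal_apply (φ : MvPolynomial σ k) : polyVal w φ = MvPowerSeries.weightedOrder w (φ : MvPowerSeries σ k) := rfl

/-- The weighted order of a monomial with non-zero coefficient is its weight. -/
theorem polyVal_monomial (α : σ →₀ ℕ) {c : k} (hc : c ≠ 0) : polyVal w (monomial α c) = Finsupp.weight w α := by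
  rw [polyVal_apply, MvPolynomial.coe_monomial, MvPowerSeries.weightedOrder_monomial_of_ne_zero w hc]

/-- Every monomial is admissible once the coordinates are (twisted Leibniz; constants are `τ`-fixed). -/
theorem admAt_polyVal_monomial (τ : MvPolynomial σ k →ₐ[k] MvPolynomial σ k) (δ : ℕ)
    (hX : ∀ i, AdmAt (polyVal w) (τ : MvPolynomial σ k →+* MvPolynomial σ k) δ (X i)) (α : σ →₀ ℕ) (c : k) :
    AdmAt (polyVal w) (τ : MvPolynomial σ k →+* MvPolynomial σ k) δ (monomial α c) := by
  rw [MvPolynomial.monomial_eq]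
  refine admAt_mul _ _ _ (admAt_of_map_eq _ _ _ ?_) ?_
  · change τ (C c) = C c
    rw [← MvPolynomial.algebraMap_eq, AlgHom.commutes]
  · exact admAt_prod _ _ _ α.support _ fun i _ => admAt_pow _ _ _ (hX i) (α i)

/-- ★★ **ADMISSIBILITY OF THE MONOMIAL VALUATION IS CHECKED ON THE COORDINATES.** For a `k`-algebra endomorphism `τ` of `k[x_σ]` and `δ`: if
`w i + δ ≤ polyVal w (τ xᵢ − xᵢ)` for every coordinate, then `polyVal w φ + δ ≤ polyVal w (τ φ − φ)` for EVERY polynomial `φ`. [OURS · L1 W4.5c] -/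
theorem polyVal_admissible (τ : MvPolynomial σ k →ₐ[k] MvPolynomial σ k) (δ : ℕ)
    (hX : ∀ i, (w i : ℕ∞) + δ ≤ polyVal w (τ (X i) - X i)) (φ : MvPolynomial σ k) :
    polyVal w φ + δ ≤ polyVal w (τ φ - φ) := by
  classical
  have hXval : ∀ i, polyVal w (X i : MvPolynomial σ k) = w i := by
    intro i
    rw [show (X i : MvPolynomial σ k) = monomial (Finsupp.single i 1) 1 from (pow_one (X i)).symm.trans X_pow_eq_monomial,
      polyVal_monomial w _ one_ne_zero, Finsupp.weight_single, one_smul]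
  have hX' : ∀ i, AdmAt (polyVal w) (τ : MvPolynomial σ k →+* MvPolynomial σ k) δ (X i) := fun i => by
    change polyVal w (X i) + δ ≤ polyVal w (τ (X i) - X i)
    rw [hXval i]
    exact hX i
  by_cases hφ : φ = 0
  · subst hφ
    simp
  -- the order of `φ` is a natural number `n`, and every exponent in the support has weight `≥ n`
  obtain ⟨n, hn⟩ : ∃ n : ℕ, polyVal w φ = n :=
    (ENat.ne_top_iff_exists.1 (by rwa [polyVal_apply, Ne, MvPowerSeries.weightedOrder_eq_top_iff, MvPolynomial.coe_eq_zero_iff])).imp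
      fun _ h => h.symm
  rw [hn]
  have hsupp : ∀ α ∈ φ.support, (n : ℕ∞) ≤ Finsupp.weight w α := fun α hα => by
    exact_mod_cast (le_weightedOrder_coe_iff w φ n).1 (by rw [← polyVal_apply, hn]) α (MvPolynomial.mem_support_iff.1 hα)
  -- `τ φ − φ` termwise
  have e : τ φ - φ = ∑ α ∈ φ.support, (τ (monomial α (coeff α φ)) - monomial α (coeff α φ)) := by
    rw [Finset.sum_sub_distrib, ← map_sum, ← φ.as_sum]
  rw [e]
  refine AddValuation.map_le_sum _ fun α hα => ?_
  calc (n : ℕ∞) + δ ≤ polyVal w (monomial α (coeff α φ)) + δ := by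
        rw [polyVal_monomial w α (MvPolynomial.mem_support_iff.1 hα)]
        exact add_le_add (hsupp α hα) le_rfl
    _ ≤ polyVal w (τ (monomial α (coeff α φ)) - monomial α (coeff α φ)) := admAt_polyVal_monomial w τ δ hX' α _

end Poly

/-! ## 3. Transfer from sections to the stalk -/

section Transfer

open CategoryTheory AlgebraicGeometry

variable {X : Scheme.{u}} {U : X.Opens} (hU : IsAffineOpen U) (x : U) {S : Type*} [CommRing S] (ψ : Γ(X, U) →+* S)
  (hψ : ∀ f : Γ(X, U), IsUnit (ψ f) ↔ (x : X) ∈ X.basicOpen f) (v : AddValuation S ℕ∞) (hv : ∀ s, v s = 0 → IsUnit s)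

/-- ★★ **ADMISSIBILITY TRANSFERS FROM SECTIONS TO THE STALK.** Let `c = ofSections hU x ψ hψ v hv`, `σ'` a ring endomorphism of `𝒪_{X,x}` and `τ` a ring
endomorphism of `Γ(X, U)` with `σ' (f_x) = (τ f)_x`, `τ` preserving non-vanishing at `x`. If `v (ψ f) + δ ≤ v (ψ (τ f − f))` for all SECTIONS `f`, then
`c` is `σ'`-admissible with `δ` on the whole stalk. [OURS · L1 W4.5c] -/
theorem CentredVal.isSigmaAdmissible_ofSections (σ' : X.presheaf.stalk (x : X) →+* X.presheaf.stalk (x : X)) (τ : Γ(X, U) →+* Γ(X, U)) (δ : ℕ)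
    (hστ : ∀ f : Γ(X, U), σ' ((X.presheaf.germ U x x.2).hom f) = (X.presheaf.germ U x x.2).hom (τ f))
    (hτ : ∀ f : Γ(X, U), (x : X) ∈ X.basicOpen f → (x : X) ∈ X.basicOpen (τ f))
    (hadm : ∀ f : Γ(X, U), v (ψ f) + δ ≤ v (ψ (τ f - f))) :
    (CentredVal.ofSections hU x ψ hψ v hv).IsSigmaAdmissible σ' δ := by
  intro y
  letI := hU.isLocalization_stalk x
  obtain ⟨⟨a, s⟩, e⟩ := IsLocalization.surj (hU.primeIdealOf x).asIdeal.primeCompl y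
  set c := CentredVal.ofSections hU x ψ hψ v hv with hc
  set γ := (X.presheaf.germ U x x.2).hom with hγ
  have e' : y * γ s = γ a := e
  have hs : (x : X) ∈ X.basicOpen (s : Γ(X, U)) := CentredVal.mem_basicOpen_of_mem_primeCompl hU x s
  have hgs : IsUnit (γ s) := (Scheme.mem_basicOpen X _ x x.2).1 hs
  have hgτs : IsUnit (γ (τ s)) := (Scheme.mem_basicOpen X _ x x.2).1 (hτ _ hs)
  have v_gs : c.v (γ s) = 0 := c.map_eq_zero_of_isUnit hgs
  have v_gτs : c.v (γ (τ s)) = 0 := c.map_eq_zero_of_isUnit hgτs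
  have cv : ∀ f : Γ(X, U), c.v (γ f) = v (ψ f) := CentredVal.ofSections_v_germ hU x ψ hψ v hv
  -- the value of `y`
  have vy : c.v y = v (ψ a) := by
    have h := congrArg c.v e'
    rw [AddValuation.map_mul, v_gs, add_zero, cv] at h
    exact h
  -- the key identity at the germ level
  have h1 : σ' y * γ (τ s) = γ (τ a) := by rw [← hστ s, ← map_mul, e', hστ a]
  have key : (σ' y - y) * (γ (τ s) * γ s) = γ ((τ a - a) * s - a * (τ s - s)) := by
    calc (σ' y - y) * (γ (τ s) * γ s) = (σ' y * γ (τ s)) * γ s - (y * γ s) * γ (τ s) := by ring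
      _ = γ (τ a) * γ s - γ a * γ (τ s) := by rw [h1, e']
      _ = γ (τ a * s - a * τ s) := by simp only [map_sub, map_mul]
      _ = γ ((τ a - a) * s - a * (τ s - s)) := by congr 1; ring
  have hval : c.v (σ' y - y) = v (ψ ((τ a - a) * s - a * (τ s - s))) := by
    have h := congrArg c.v key
    rw [AddValuation.map_mul, AddValuation.map_mul, v_gs, v_gτs, add_zero, add_zero, cv] at h
    exact h
  rw [vy, hval, map_sub ψ, map_mul, map_mul]
  refine le_trans (le_min ?_ ?_) (v.map_sub _ _)
  · rw [AddValuation.map_mul]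
    exact (hadm a).trans le_self_add
  · rw [AddValuation.map_mul]
    calc v (ψ a) + (δ : ℕ∞) ≤ v (ψ a) + (v (ψ s) + δ) := add_le_add le_rfl le_add_self
      _ ≤ v (ψ a) + v (ψ (τ s - s)) := add_le_add le_rfl (hadm s)

end Transfer

end Summit.ResolutionOfSingularities.ResolutionOfSingularities.Theorems.WildQuotientResolution.S1.Valuative

end
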